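import Summits.NavierStokesRegularity.NavierStokesRegularity.Theses.AngularGalerkinLadder
import Summits.NavierStokesRegularity.NavierStokesRegularity.Theorems.NoOverheating.Negative.LadderLimitExposed
import Summits.NavierStokesRegularity.NavierStokesRegularity.Theorems.NoOverheating.Negative.AxisymmetricWindowsExcluded
import Summits.NavierStokesRegularity.NavierStokesRegularity.Theorems.NoOverheating.Negative.ScrewPeriodicWindowsExcluded
import Literature.Analysis.FluidPDE.AncientAxisymmetricTypeILiouville
import Literature.Analysis.FluidPDE.KNSSTypeIIProofs
import HarnessLib

/-!
# Census strata (S18)–(S20), SEQUENCE level: no admissible window sequence is ASYMPTOTICALLY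
# axisymmetric, ASYMPTOTICALLY screw- or translation-invariant in norm on the window slice, or
# ASYMPTOTICALLY steady — symmetry DEFECTS tending to zero along the sequence are excluded, not only
# exact symmetries

Refuter seat (ns-blowup-refuter g18), kernel census for crux K2 `NoOverheating`
(stmt-NavierStokesRegularity-19960) of route `AngularGalerkinLadder`, Negative lane (`--supports`).
No definition, no named fact, no item verdict moves.

The exact-symmetry strata of the census are stated profile by profile: (S1) every slice
axisymmetric, (S10)/(S17) a window slice with screw-invariant / screw-monotone norm, (S11b) a steady
profile.  A window sequence whose profiles are NOT symmetric but whose symmetry DEFECT tends to zero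
as `n → ∞` escapes all of them.  This file closes that gap with the ladder limit
(`exists_ladderLimit_typeI`, KJ-31/K3: a subsequence converges pointwise on `t < 0` to a NONTRIVIAL
Type-I (`C₀`) ancient mild solution `v` keeping the amplitude floor `δ ≤ ‖v(−1, x₀)‖`): pointwise
symmetry defects `→ 0` make the LIMIT exactly symmetric, and the limit is killed by the printed /
kinematic Liouville statement of the exact stratum:

* (S18) `no_windowSequence_asymptoticallyAxisymmetric` — for a fixed frame `A` (axis `A e₃`) and
  every angle `θ`, `A⁻¹uₙ(t, A R_θ x) − R_θ A⁻¹uₙ(t, A x) → 0` pointwise ⟹ the limit is axisymmetric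
  about `A e₃` ⟹ KNSS 2009 Thm 5.3 (`ae_eq_zero_of_isAxisymmetric_conj_of_hasTypeIDecay`) ⟹ `v = 0`
  a.e., contradiction;
* (S19) `no_windowSequence_asymptoticallyScrewInvariantNorm` — for one screw displacement
  `x ↦ S x + b`, `S b = b ≠ 0` (translations `S = 1`, helical / periodic symmetry),
  `‖uₙ(−1, S x + b)‖ − ‖uₙ(−1, x)‖ → 0` pointwise ⟹ `‖v(−1, S x + b)‖ = ‖v(−1, x)‖` ⟹ Type-I decay
  kills `v(−1, ·)` (`eq_zero_of_decay_of_norm_le_norm_screw`), against `δ ≤ ‖v(−1, x₀)‖`;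
* (S20) `no_windowSequence_asymptoticallySteady` — `uₙ(t, x) − uₙ(s, x) → 0` pointwise for all
  `s, t < 0` ⟹ `v` steady ⟹ a steady field with Type-I decay `C₀ / (‖x‖ + √(−t))`, uniform over
  all `t < 0`, vanishes (`eq_zero_of_steady_of_hasTypeIDecay`: let `t → −∞`), against the floor.

Census reading: K2's supply cannot DEGENERATE TOWARDS a symmetric configuration along the ladder —
not towards axisymmetry about a fixed axis, not towards a screw- or translation-invariant (2D-like,
periodic, helical) window slice, not towards a steady state — even if no single profile is
symmetric.  Frames may vary with `n` (`no_windowSequence_asymptoticallyAxisymmetric_varying`: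
compactness of the isometry group, `exists_subseq_tendsto_linearIsometryEquiv`, and slice-locally-
uniform convergence, as in (S1)'s `…_varying` form).

References: [cite: KochNadirashviliSereginSverak2009, Thm. 5.3 and §6 (axisymmetric Type-I Liouville); Lemma 6.1 (limits of rescaled solutions)];
[cite: SereginSverak2009, Thm. 1.1 (Type-I axisymmetric blow-up excluded via ancient limits)];
[cite: MahalovTitiLeibovich1990, Thm. 3.3 (global strong helical solutions; quoted in Robinson–Rodrigo–Sadowski 2016, p. 112)].
-/

noncomputable section

namespace Summit.NavierStokesRegularity.AngularGalerkinLadderAsymptoticSymmetryExcluded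

open Set Function Filter Topology Metric MeasureTheory
open Literature.Analysis Literature.Analysis.FluidPDE
open Summit.NavierStokesRegularity.FluidComputer
open Summit.NavierStokesRegularity.FluidComputer.AngularLadder
open Summit.NavierStokesRegularity.NavierStokesRegularity.Theses.AngularGalerkinLadder
open Summit.NavierStokesRegularity.AngularGalerkinLadderLadderLimit
open Summit.NavierStokesRegularity.AngularGalerkinLadderAxisymmetricWindowsExcluded
open Summit.NavierStokesRegularity.AngularGalerkinLadderScrewPeriodicExcluded

/-! ### §1 Symmetry defects tending to zero pass to pointwise limits -/

/-- A pointwise limit of fields whose axisymmetry defect tends to zero pointwise is axisymmetric.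
[cite: KochNadirashviliSereginSverak2009, Lemma 6.1 (limits of rescaled solutions)] -/
theorem isAxisymmetric_of_tendsto_of_defect_tendsto_zero
    {f : ℕ → EuclideanSpace ℝ (Fin 3) → EuclideanSpace ℝ (Fin 3)}
    {g : EuclideanSpace ℝ (Fin 3) → EuclideanSpace ℝ (Fin 3)}
    (hlim : ∀ x, Tendsto (fun n => f n x) atTop (𝓝 (g x)))
    (hdef : ∀ θ x, Tendsto (fun n => f n (rotZ θ x) - rotZ θ (f n x)) atTop (𝓝 0)) :
    IsAxisymmetric g := by
  intro θ x
  have h1 : Tendsto (fun n => f n (rotZ θ x)) atTop (𝓝 (g (rotZ θ x))) := hlim _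
  have h2 : Tendsto (fun n => rotZ θ (f n x)) atTop (𝓝 (rotZ θ (g x))) :=
    ((continuous_rotZ θ).tendsto _).comp (hlim x)
  exact sub_eq_zero.1 (tendsto_nhds_unique (h1.sub h2) (hdef θ x))

/-- **Asymptotic axisymmetry about MOVING axes passes to locally uniform limits**: if the
axisymmetry defect of `f_n` about the axis `A_n e₃` tends to zero pointwise, `A_n → A'` pointwise,
and `f_n → g` locally uniformly with `g` continuous, then `g` is axisymmetric about `A' e₃`.
[cite: KochNadirashviliSereginSverak2009, Lemma 6.1 (limits of rescaled solutions)] -/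
theorem isAxisymmetric_conj_of_tendstoLocallyUniformly_of_defect_tendsto_zero
    {f : ℕ → EuclideanSpace ℝ (Fin 3) → EuclideanSpace ℝ (Fin 3)}
    {g : EuclideanSpace ℝ (Fin 3) → EuclideanSpace ℝ (Fin 3)}
    {A : ℕ → (EuclideanSpace ℝ (Fin 3) ≃ₗᵢ[ℝ] EuclideanSpace ℝ (Fin 3))}
    {A' : EuclideanSpace ℝ (Fin 3) ≃ₗᵢ[ℝ] EuclideanSpace ℝ (Fin 3)}
    (hA : ∀ x, Tendsto (fun n => A n x) atTop (𝓝 (A' x)))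
    (hlim : TendstoLocallyUniformly f g atTop) (hg : Continuous g)
    (hdef : ∀ θ x, Tendsto (fun n => (A n).symm (f n (A n (rotZ θ x))) -
      rotZ θ ((A n).symm (f n (A n x)))) atTop (𝓝 0)) :
    IsAxisymmetric (fun x => A'.symm (g (A' x))) := by
  intro θ x
  have hL : Tendsto (fun n => (A n).symm (f n (A n (rotZ θ x)))) atTop
      (𝓝 (A'.symm (g (A' (rotZ θ x))))) :=
    tendsto_linearIsometryEquiv_symm_apply_of_tendsto hA
      (hlim.tendsto_comp hg.continuousAt (hA (rotZ θ x)))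
  have hR : Tendsto (fun n => rotZ θ ((A n).symm (f n (A n x)))) atTop
      (𝓝 (rotZ θ (A'.symm (g (A' x))))) :=
    ((continuous_rotZ θ).tendsto _).comp
      (tendsto_linearIsometryEquiv_symm_apply_of_tendsto hA
        (hlim.tendsto_comp hg.continuousAt (hA x)))
  exact sub_eq_zero.1 (tendsto_nhds_unique (hL.sub hR) (hdef θ x))

/-- A pointwise limit of fields whose norm defect under a displacement `T` tends to zero pointwise
has `T`-invariant norm. [cite: KochNadirashviliSereginSverak2009, Lemma 6.1 (limits of rescaled solutions)] -/
theorem norm_comp_eq_of_tendsto_of_defect_tendsto_zero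
    {f : ℕ → EuclideanSpace ℝ (Fin 3) → EuclideanSpace ℝ (Fin 3)}
    {g : EuclideanSpace ℝ (Fin 3) → EuclideanSpace ℝ (Fin 3)}
    (T : EuclideanSpace ℝ (Fin 3) → EuclideanSpace ℝ (Fin 3))
    (hlim : ∀ x, Tendsto (fun n => f n x) atTop (𝓝 (g x)))
    (hdef : ∀ x, Tendsto (fun n => ‖f n (T x)‖ - ‖f n x‖) atTop (𝓝 0))
    (x : EuclideanSpace ℝ (Fin 3)) : ‖g (T x)‖ = ‖g x‖ := by
  have h1 : Tendsto (fun n => ‖f n (T x)‖) atTop (𝓝 ‖g (T x)‖) := (hlim _).norm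
  have h2 : Tendsto (fun n => ‖f n x‖) atTop (𝓝 ‖g x‖) := (hlim x).norm
  exact sub_eq_zero.1 (tendsto_nhds_unique (h1.sub h2) (hdef x))

/-- A pointwise limit (on `t < 0`) of time-dependent fields whose unsteadiness `fₙ(t) − fₙ(s)` tends
to zero pointwise is steady on `t < 0`. [cite: KochNadirashviliSereginSverak2009, Lemma 6.1 (limits of rescaled solutions)] -/
theorem steady_of_tendsto_of_defect_tendsto_zero
    {f : ℕ → ℝ → EuclideanSpace ℝ (Fin 3) → EuclideanSpace ℝ (Fin 3)}
    {g : ℝ → EuclideanSpace ℝ (Fin 3) → EuclideanSpace ℝ (Fin 3)}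
    (hlim : ∀ t < 0, ∀ x, Tendsto (fun n => f n t x) atTop (𝓝 (g t x)))
    (hdef : ∀ s < 0, ∀ t < 0, ∀ x, Tendsto (fun n => f n t x - f n s x) atTop (𝓝 0)) :
    ∀ s < 0, ∀ t < 0, ∀ x, g s x = g t x := by
  intro s hs t ht x
  have h := tendsto_nhds_unique ((hlim t ht x).sub (hlim s hs x)) (hdef s hs t ht x)
  exact (sub_eq_zero.1 h).symm

/-- **A steady field with Type-I decay `C / (‖x‖ + √(−t))`, uniform over all `t < 0`, vanishes**:
`‖v(t, x)‖ = ‖v(s, x)‖ ≤ C / (‖x‖ + √(−s)) → 0` as `s → −∞`.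
[cite: KochNadirashviliSereginSverak2009, Thm. 5.3 and §6 (axisymmetric Type-I Liouville); Lemma 6.1 (limits of rescaled solutions)] -/
theorem eq_zero_of_steady_of_hasTypeIDecay
    {v : ℝ → EuclideanSpace ℝ (Fin 3) → EuclideanSpace ℝ (Fin 3)} {C : ℝ} (hTI : HasTypeIDecay C v)
    (hst : ∀ s < 0, ∀ t < 0, ∀ x, v s x = v t x) : ∀ t < 0, ∀ x, v t x = 0 := by
  intro t ht x
  by_contra hx
  have hε : 0 < ‖v t x‖ := norm_pos_iff.2 hx
  set A : ℝ := |C| / ‖v t x‖ + 1 with hA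
  have hA0 : 0 < A := by positivity
  have hs : -(A ^ 2) < 0 := by have := pow_pos hA0 2; linarith
  have h1 := hTI (-(A ^ 2)) hs x
  rw [neg_neg, Real.sqrt_sq hA0.le, hst (-(A ^ 2)) hs t ht x] at h1
  have hpos : 0 < ‖x‖ + A := by positivity
  have h2 := (le_div_iff₀ hpos).1 h1
  have h3 : ‖v t x‖ * A = |C| + ‖v t x‖ := by
    rw [hA, mul_add, mul_one, mul_div_cancel₀ _ hε.ne']
  rw [mul_add, h3] at h2
  have h4 : 0 ≤ ‖v t x‖ * ‖x‖ := mul_nonneg (norm_nonneg _) (norm_nonneg _)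
  linarith [le_abs_self C]

/-! ### §2 The three sequence-level strata -/

variable {C₀ cmin cmax δ : ℝ} {L : ℕ → ℕ} {ε c : ℕ → ℝ}
  {R : ℕ → (EuclideanSpace ℝ (Fin 3) ≃ₗᵢ[ℝ] EuclideanSpace ℝ (Fin 3))}
  {u : ℕ → ℝ → EuclideanSpace ℝ (Fin 3) → EuclideanSpace ℝ (Fin 3)}
  {p : ℕ → ℝ → EuclideanSpace ℝ (Fin 3) → ℝ}
  {d : ℕ → ℝ → EuclideanSpace ℝ (Fin 3) → EuclideanSpace ℝ (Fin 3)}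

/-- **(S18) No admissible window sequence is asymptotically axisymmetric about a fixed axis
`A e₃`.**  If, for every angle `θ`, every `t < 0` and every `x`, the axisymmetry defect
`A⁻¹uₙ(t, A R_θ x) − R_θ A⁻¹uₙ(t, A x)` tends to `0`, the ladder limit is an axisymmetric nontrivial
Type-I ancient mild solution — excluded by KNSS 2009, Thm. 5.3.
[cite: KochNadirashviliSereginSverak2009, Thm. 5.3 and §6 (axisymmetric Type-I Liouville); Lemma 6.1 (limits of rescaled solutions)] -/
theorem no_windowSequence_asymptoticallyAxisymmetric (hcmin : 1 < cmin) (hδ : 0 < δ)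
    (hε : Tendsto ε atTop (𝓝 0))
    (hW : ∀ n, IsWindowProfile (L n) C₀ cmin cmax δ (ε n) (c n) (R n) (u n) (p n) (d n))
    (A : EuclideanSpace ℝ (Fin 3) ≃ₗᵢ[ℝ] EuclideanSpace ℝ (Fin 3))
    (hdef : ∀ θ, ∀ t < 0, ∀ x,
      Tendsto (fun n => A.symm (u n t (A (rotZ θ x))) - rotZ θ (A.symm (u n t (A x)))) atTop
        (𝓝 0)) :
    False := by
  obtain ⟨φ, c', R', v, hφ, -, hptw, -, -, -, hmild, hmeas, -, hTI, hnz⟩ :=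
    exists_ladderLimit hcmin hδ hε hW
  have hvax : ∀ t < 0, IsAxisymmetric (fun x => A.symm (v t (A x))) := fun t ht =>
    isAxisymmetric_of_tendsto_of_defect_tendsto_zero (f := fun n x => A.symm (u (φ n) t (A x)))
      (fun x => (A.symm.continuous.tendsto _).comp (hptw t ht (A x)))
      (fun θ x => (hdef θ t ht x).comp hφ.tendsto_atTop)
  exact hnz (hmild.ae_eq_zero_of_isAxisymmetric_conj_of_hasTypeIDecay hmeas A hvax hTI)

/-- (S18) about the `x₃`-axis itself (`A = 1`). [cite: KochNadirashviliSereginSverak2009, Thm. 5.3 and §6 (axisymmetric Type-I Liouville); Lemma 6.1 (limits of rescaled solutions)] -/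
theorem no_windowSequence_asymptoticallyAxisymmetric_z (hcmin : 1 < cmin) (hδ : 0 < δ)
    (hε : Tendsto ε atTop (𝓝 0))
    (hW : ∀ n, IsWindowProfile (L n) C₀ cmin cmax δ (ε n) (c n) (R n) (u n) (p n) (d n))
    (hdef : ∀ θ, ∀ t < 0, ∀ x,
      Tendsto (fun n => u n t (rotZ θ x) - rotZ θ (u n t x)) atTop (𝓝 0)) :
    False :=
  no_windowSequence_asymptoticallyAxisymmetric hcmin hδ hε hW (LinearIsometryEquiv.refl ℝ _)
    hdef

/-- **(S18), moving axes**: no admissible window sequence is asymptotically axisymmetric about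
axes `Aₙ e₃` with ARBITRARY frames `Aₙ` — along a subsequence the frames converge (compactness of
the isometry group), the ladder limit of that subsequence is axisymmetric about the limit axis
(slice-locally-uniform convergence), and KNSS 2009 Thm. 5.3 kills it.
[cite: KochNadirashviliSereginSverak2009, Thm. 5.3 and §6 (axisymmetric Type-I Liouville); Lemma 6.1 (limits of rescaled solutions)] -/
theorem no_windowSequence_asymptoticallyAxisymmetric_varying (hcmin : 1 < cmin) (hδ : 0 < δ)
    (hε : Tendsto ε atTop (𝓝 0))
    (hW : ∀ n, IsWindowProfile (L n) C₀ cmin cmax δ (ε n) (c n) (R n) (u n) (p n) (d n))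
    (A : ℕ → (EuclideanSpace ℝ (Fin 3) ≃ₗᵢ[ℝ] EuclideanSpace ℝ (Fin 3)))
    (hdef : ∀ θ, ∀ t < 0, ∀ x,
      Tendsto (fun n => (A n).symm (u n t (A n (rotZ θ x))) - rotZ θ ((A n).symm (u n t (A n x))))
        atTop (𝓝 0)) :
    False := by
  -- the frames converge along `ψ`
  obtain ⟨ψ, A', hψ, -, hAψ⟩ := exists_subseq_tendsto_linearIsometryEquiv A
  -- the subsequence is again an admissible window sequence; take its ladder limit
  obtain ⟨φ, c', R', v, hφ, -, -, hloc, hvcont, -, hmild, hmeas, -, hTI, hnz⟩ :=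
    exists_ladderLimit (L := L ∘ ψ) (ε := ε ∘ ψ) (c := c ∘ ψ) (R := R ∘ ψ) (u := u ∘ ψ)
      (p := p ∘ ψ) (d := d ∘ ψ) hcmin hδ (hε.comp hψ.tendsto_atTop) (fun n => hW (ψ n))
  have hvax : ∀ t < 0, IsAxisymmetric (fun x => A'.symm (v t (A' x))) := fun t ht =>
    isAxisymmetric_conj_of_tendstoLocallyUniformly_of_defect_tendsto_zero
      (A := fun n => A (ψ (φ n))) (f := fun n => u (ψ (φ n)) t)
      (fun x => (hAψ x).comp hφ.tendsto_atTop) (hloc t ht)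
      (continuous_slice_of_continuousOn_Iio hvcont ht)
      (fun θ x => (hdef θ t ht x).comp (hψ.tendsto_atTop.comp hφ.tendsto_atTop))
  exact hnz (hmild.ae_eq_zero_of_isAxisymmetric_conj_of_hasTypeIDecay hmeas A' hvax hTI)

/-- **(S19) No admissible window sequence has asymptotically screw-invariant window-slice norms**:
for one screw displacement `x ↦ S x + b` with `S b = b ≠ 0` (translations: `S = 1`; helical and
periodic symmetry), `‖uₙ(−1, S x + b)‖ − ‖uₙ(−1, x)‖ → 0` pointwise is contradictory — the ladder
limit has an `S`-screw-invariant window-slice norm and Type-I decay, so `v(−1, ·) = 0`, against the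
amplitude floor `δ ≤ ‖v(−1, x₀)‖`.
[cite: MahalovTitiLeibovich1990, Thm. 3.3 (global strong helical solutions; quoted in Robinson–Rodrigo–Sadowski 2016, p. 112)] -/
theorem no_windowSequence_asymptoticallyScrewInvariantNorm (hcmin : 1 < cmin) (hδ : 0 < δ)
    (hε : Tendsto ε atTop (𝓝 0))
    (hW : ∀ n, IsWindowProfile (L n) C₀ cmin cmax δ (ε n) (c n) (R n) (u n) (p n) (d n))
    (S : EuclideanSpace ℝ (Fin 3) ≃ₗᵢ[ℝ] EuclideanSpace ℝ (Fin 3)) {b : EuclideanSpace ℝ (Fin 3)}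
    (hSb : S b = b) (hb : b ≠ 0)
    (hdef : ∀ x, Tendsto (fun n => ‖u n (-1) (S x + b)‖ - ‖u n (-1) x‖) atTop (𝓝 0)) :
    False := by
  obtain ⟨φ, c', R', v, hφ, -, -, -, hptw, -, -, -, -, -, -, hTI, ⟨x₀, hx₀⟩, -⟩ :=
    exists_ladderLimit_typeI hcmin hδ hε hW
  have hinv : ∀ x, ‖v (-1) (S x + b)‖ = ‖v (-1) x‖ :=
    norm_comp_eq_of_tendsto_of_defect_tendsto_zero (f := fun n => u (φ n) (-1)) (fun y => S y + b)
      (hptw (-1) (by norm_num)) (fun x => (hdef x).comp hφ.tendsto_atTop)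
  have hzero : v (-1) x₀ = 0 :=
    eq_zero_of_decay_of_norm_le_norm_screw (Real.sqrt_pos.2 (by norm_num))
      (hTI (-1) (by norm_num)) S hSb hb (fun x => (hinv x).symm.le) x₀
  rw [hzero, norm_zero] at hx₀
  exact absurd hx₀ (not_le.2 hδ)

/-- (S19) for translations: `‖uₙ(−1, x + b)‖ − ‖uₙ(−1, x)‖ → 0` pointwise, `b ≠ 0` — the window
slices cannot become periodic / `b`-independent in norm along the sequence.
[cite: MahalovTitiLeibovich1990, Thm. 3.3 (global strong helical solutions; quoted in Robinson–Rodrigo–Sadowski 2016, p. 112)] -/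
theorem no_windowSequence_asymptoticallyTranslationInvariantNorm (hcmin : 1 < cmin) (hδ : 0 < δ)
    (hε : Tendsto ε atTop (𝓝 0))
    (hW : ∀ n, IsWindowProfile (L n) C₀ cmin cmax δ (ε n) (c n) (R n) (u n) (p n) (d n))
    {b : EuclideanSpace ℝ (Fin 3)} (hb : b ≠ 0)
    (hdef : ∀ x, Tendsto (fun n => ‖u n (-1) (x + b)‖ - ‖u n (-1) x‖) atTop (𝓝 0)) : False :=
  no_windowSequence_asymptoticallyScrewInvariantNorm hcmin hδ hε hW (LinearIsometryEquiv.refl ℝ _)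
    rfl hb (by simpa using hdef)

/-- **(S20) No admissible window sequence is asymptotically steady**: `uₙ(t, x) − uₙ(s, x) → 0`
pointwise for all `s, t < 0` is contradictory — the ladder limit is steady with Type-I decay, hence
zero, against the amplitude floor.
[cite: KochNadirashviliSereginSverak2009, Thm. 5.3 and §6 (axisymmetric Type-I Liouville); Lemma 6.1 (limits of rescaled solutions)] -/
theorem no_windowSequence_asymptoticallySteady (hcmin : 1 < cmin) (hδ : 0 < δ)
    (hε : Tendsto ε atTop (𝓝 0))
    (hW : ∀ n, IsWindowProfile (L n) C₀ cmin cmax δ (ε n) (c n) (R n) (u n) (p n) (d n))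
    (hdef : ∀ s < 0, ∀ t < 0, ∀ x, Tendsto (fun n => u n t x - u n s x) atTop (𝓝 0)) :
    False := by
  obtain ⟨φ, c', R', v, hφ, -, -, -, hptw, -, -, -, -, -, -, hTI, ⟨x₀, hx₀⟩, -⟩ :=
    exists_ladderLimit_typeI hcmin hδ hε hW
  have hst : ∀ s < 0, ∀ t < 0, ∀ x, v s x = v t x :=
    steady_of_tendsto_of_defect_tendsto_zero (f := fun n => u (φ n)) hptw
      (fun s hs t ht x => (hdef s hs t ht x).comp hφ.tendsto_atTop)
  rw [eq_zero_of_steady_of_hasTypeIDecay hTI hst (-1) (by norm_num) x₀, norm_zero] at hx₀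
  exact absurd hx₀ (not_le.2 hδ)

/-! ### §3 The K1 ∧ K2 readings -/

/-- **The three sequence-level strata in census form**: an admissible window sequence is neither
asymptotically axisymmetric about moving axes `Aₙ e₃` (S18), nor asymptotically screw-invariant in
window-slice norm (S19), nor asymptotically steady (S20).
[cite: KochNadirashviliSereginSverak2009, Thm. 5.3 and §6 (axisymmetric Type-I Liouville); Lemma 6.1 (limits of rescaled solutions)] -/
theorem no_windowSequence_asymptoticallySymmetric_census (hcmin : 1 < cmin) (hδ : 0 < δ)
    (hε : Tendsto ε atTop (𝓝 0))
    (hW : ∀ n, IsWindowProfile (L n) C₀ cmin cmax δ (ε n) (c n) (R n) (u n) (p n) (d n)) :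
    ¬ ((∃ A : ℕ → (EuclideanSpace ℝ (Fin 3) ≃ₗᵢ[ℝ] EuclideanSpace ℝ (Fin 3)), ∀ θ, ∀ t < 0, ∀ x,
          Tendsto (fun n => (A n).symm (u n t (A n (rotZ θ x))) -
            rotZ θ ((A n).symm (u n t (A n x)))) atTop (𝓝 0)) ∨
       (∃ (S : EuclideanSpace ℝ (Fin 3) ≃ₗᵢ[ℝ] EuclideanSpace ℝ (Fin 3))
          (b : EuclideanSpace ℝ (Fin 3)), S b = b ∧ b ≠ 0 ∧
          ∀ x, Tendsto (fun n => ‖u n (-1) (S x + b)‖ - ‖u n (-1) x‖) atTop (𝓝 0)) ∨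
       (∀ s < 0, ∀ t < 0, ∀ x, Tendsto (fun n => u n t x - u n s x) atTop (𝓝 0))) := by
  rintro (⟨A, hA⟩ | ⟨S, b, hSb, hb, hdef⟩ | hst)
  · exact no_windowSequence_asymptoticallyAxisymmetric_varying hcmin hδ hε hW A hA
  · exact no_windowSequence_asymptoticallyScrewInvariantNorm hcmin hδ hε hW S hSb hb hdef
  · exact no_windowSequence_asymptoticallySteady hcmin hδ hε hW hst

end Summit.NavierStokesRegularity.AngularGalerkinLadderAsymptoticSymmetryExcluded

end
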